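import Summits.ABC.IUTFork.Cor312IdentifiedNonVacuitySigns
import HarnessLib

/-!
# IUT REPAIR branch, sub-cell B5 — ESCAPE CENSUS VI(a): the FLIP SHELLS — a non-scalar «Ism» whose indeterminacies PERMUTE the tensor log-shell

MODEL DATA + folklore lemmas (D-0012; toys over abc-iut-c312-7's one-place `toyIndex`, `l⋇ = 2`; no `Prop` fact, nothing asserted about print) of
the abc-iut cell's IUT REPAIR branch (human ruling D-0077(2); REPAIR-SPEC §4 row RP-S02, door (b); rung LADDER-ABC:A2.RP ⊆ A2.B), seat abc-iut-rp-s2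
(gen 2), ONE builder (abc-iut-rp-plan RULINGS #11 (1)). Sequel of `ObstructionSS2/4/6/8/10/12` (p428259, p428483, p428766, p429375, p431972, p432529);
continued in `ObstructionSS16` (data, typed Thm. 3.11, pinned setting, S) and `ObstructionSS18` (hull, bridge hypotheses, Statement, what fails).
TAKES NO SIDE on [IUTchIII] Cor. 3.12 or on any author (Mochizuki / Scholze–Stix / Joshi / Dupuy–Hilado); typed ≠ proved; instantiated ≠ endorsed.

WHY. The level-R no-go of record (`PinnedLink.not_pilotKummerIndRelated_of_absLogQPos` p419757 = P1 `supplier_false_on_honest` = P4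
`barrier_identification`; B5's `ObstructionSS1/3/5/8/6/30` forms) refutes S = `Cor312Vol.PilotKummerIndRelated` from the pins + Step (x) + one honestly
scaled packet; abc-iut-rp-s3's premise census (`ObstructionSS30`, p433369) isolates its bottom element: VOLUME-RIGIDITY of `⟨(Ind1) ∪ (Ind2)⟩` on ONE
orbit («hiso»). Every door-(b) model on record (`ObstructionSS10/12`, `CandJoshi22`, `ObstructionSS6Witness`, `CandJoshi7`) realises a non-isometric
indeterminacy as a SCALAR `p^k` on a packet LINE, whose orbit leaves every hull-set: S holds but `−|log(Θ)| = +∞` (`ObstructionSS2` monodromy,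
`ObstructionSS6` Haar price), and abc-iut-w4-d006's `Cor312ScalarIsmDichotomy.orbit_dichotomy` (p430912) shows that over a SCALAR Ism no bounded
proper enlargement of a ball exists at all. Whether that price is intrinsic to door (b) — whether `ObstructionSS6`'s Haar binder `hHaar` (p428766)
and the orbit-isometry binder `hiso` can be DROPPED from the no-go — was the one open cell of the RP-S02 census (gen-0 HANDOFF block #2). The three
files answer it with a model whose Ism is NOT scalar: door (b″), a NON-HAAR indeterminacy with BOUNDED orbit.

THIS FILE — THE BED. `flipShells`: carrier `log(𝒟⊢_v) := ℚ²` (the plane, NOT a line), log-shell the unit box, strip-automorphisms and "Ism" both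
`{1, cflip}` (`cflip` = the coordinate swap, a `ℚ`-linear involution; [IUTchIII] Prop. 1.2 (vi)/(vii) read with a two-element group, as the sign
shells read it with `{±1}`). Its `(j+1)`-tensor packets are genuine `PiTensorProduct`s `(ℚ²)^{⊗(j+1)}`; the BASIS PURE TENSORS `e_{ε₀} ⊗ ⋯ ⊗ e_{ε_j}`
(`bpure`), among them the Θ-VECTOR `e₀^{⊗(j+1)}` (`aVec`) and the q-VECTOR `e₁^{⊗(j+1)}` (`bVec`), are separated by the coordinate functional `coord k`
(`x₀ ⊗ ⋯ ⊗ x_j ↦ ∏_i (x_i)_k`, `aVec_ne_bVec`); the FLIP FAMILY `flipFam ∈ (Ind2)` («flip on every summand of every factor») swaps them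
(`flipFam_aVec`, `flipFam_bVec`); the TENSOR LOG-SHELL `tShell j v_ℚ` = the `2^{j+1}` basis pure tensors is a FINITE set that EVERY element of
`⟨(Ind1) ∪ (Ind2)⟩` PERMUTES (`image_tShell_of_mem_closure`: the generators map it into itself — a permutation of the capsule permutes the indices,
a flip flips them —, a linear automorphism mapping a finite set into itself maps it onto itself, then closure induction). So every indeterminacy orbit of
the Θ-vector stays inside the tensor log-shell (`apply_aVec_mem_tShell`) — print's own mechanism for «the [easily verified] compactness of the 𝒰»
(Cor. 3.12 proof, p. 175 l. 2–4: (Ind1), (Ind2) preserve the integral structure) — while the flip MOVES the Θ-vector: non-(Ind)-trivial (RULINGS #11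
PROFILE) and bounded at once, which no scalar bed is. S. Mochizuki, *Inter-universal Teichmüller theory III*, kurims manuscript (May 2020) =
`paper:url-4b091feeb646` (cell render). [cite: ScholzeStix2018, §2.2 pp. 9–10] (door (b): FILE p. 10 l. 18–23) [claim: Mochizuki2012, status: disputed]
Standard axioms only; nothing asserted.
-/

noncomputable section

open Set

namespace Summit.ABC.IUTFork.Repair.ObstructionSS14

open Thm311 Cor312 Cor312.Checks Cor312.IdentifiedNonVacuity Literature.IUT.LogThetaLattice

/-! ## 1. The cflip shells: carrier the plane `ℚ²`, "Ism" the coordinate cflip -/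

/-- The plane `ℚ²` — the mono-analytic carrier `log(𝒟⊢_v)` of the cflip shells. MODEL DATA. [folklore] -/
abbrev Plane : Type := Fin 2 → ℚ

/-- The coordinate cflip `(x₀, x₁) ↦ (x₁, x₀)` of the plane (a `ℚ`-linear involution). MODEL DATA. [folklore] -/
def cflip : Plane ≃ₗ[ℚ] Plane := LinearEquiv.funCongrLeft ℚ ℚ (Equiv.swap (0 : Fin 2) 1)

/-- The cflip swaps the coordinates. [folklore] -/
theorem cflip_apply (x : Plane) (k : Fin 2) : cflip x k = x (Equiv.swap (0 : Fin 2) 1 k) := rfl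

/-- The cflip is an involution. [folklore] -/
theorem cflip_cflip (x : Plane) : cflip (cflip x) = x := by
  funext k; rw [cflip_apply, cflip_apply, Equiv.swap_apply_self]

/-- The cflip moves the basis vector `e_k` to `e_{swap k}`. [folklore] -/
theorem cflip_single (k : Fin 2) : cflip (Pi.single k 1) = Pi.single (Equiv.swap (0 : Fin 2) 1 k) 1 := by
  funext k'
  rw [cflip_apply]
  by_cases h : k' = Equiv.swap (0 : Fin 2) 1 k
  · subst h; rw [Equiv.swap_apply_self, Pi.single_eq_same, Pi.single_eq_same]
  · rw [Pi.single_eq_of_ne h, Pi.single_eq_of_ne]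
    intro h'; apply h; rw [← h', Equiv.swap_apply_self]

/-- "Ism" of the cflip shells: the identity and the cflip (a group of order two). MODEL DATA. [claim: Mochizuki2012, status: disputed] -/
def flips : Set (Plane ≃ₗ[ℚ] Plane) := {LinearEquiv.refl ℚ Plane, cflip}

/-- An element of `flips` is an involution. [folklore] -/
theorem apply_apply_of_mem_flips {g : Plane ≃ₗ[ℚ] Plane} (hg : g ∈ flips) (x : Plane) : g (g x) = x := by
  rcases hg with rfl | rfl
  · rfl
  · exact cflip_cflip x

/-- An element of `flips` maps a basis vector to a basis vector. [folklore] -/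
theorem exists_single_of_mem_flips {g : Plane ≃ₗ[ℚ] Plane} (hg : g ∈ flips) (k : Fin 2) :
    ∃ k' : Fin 2, g (Pi.single k 1) = Pi.single k' 1 := by
  rcases hg with rfl | rfl
  · exact ⟨k, rfl⟩
  · exact ⟨_, cflip_single k⟩

/-- **The FLIP SHELLS** over abc-iut-c312-7's one-place index: `log(𝒟⊢_v) := ℚ²`, log-shell the unit box, strip-automorphisms
and "Ism" both `{1, cflip}` (an `abbrev`, so the carrier reduces to `Fin 2 → ℚ`). MODEL DATA. [claim: Mochizuki2012, status: disputed] -/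
abbrev flipShells : LogShells toyIndex where
  carrier := fun _ => Plane
  shell := fun _ => {x | ∀ k, |x k| ≤ 1}
  stripAut := fun _ => flips
  ism := fun _ => flips
  one_mem_stripAut := fun _ => Set.mem_insert _ _
  one_mem_ism := fun _ => Set.mem_insert _ _

/-! ## 2. Basis bpure tensors, the coordinate functional, the cflip family -/

/-- The basis vector `e_k` of the 1-packet `Fibre → ℚ²` (one-point fibre). MODEL DATA. [folklore] -/
def bvec (k : Fin 2) (vQ : toyIndex.VQ) : flipShells.Packet1 vQ := fun _ => Pi.single k 1

/-- The BASIS PURE TENSORS `e_{ε₀} ⊗ ⋯ ⊗ e_{ε_j}` of the `(j+1)`-tensor packet `(ℚ²)^{⊗(j+1)}`. MODEL DATA. [folklore] -/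
def bpure (j : toyIndex.Label) (vQ : toyIndex.VQ) (ε : toyIndex.Caps j → Fin 2) : flipShells.Packet j vQ :=
  flipShells.tprod j vQ fun i => bvec (ε i) vQ

/-- The Θ-VECTOR `e₀ ⊗ ⋯ ⊗ e₀` at label `j`. MODEL DATA. [claim: Mochizuki2012, status: disputed] -/
def aVec (j : toyIndex.Label) (vQ : toyIndex.VQ) : flipShells.Packet j vQ := bpure j vQ fun _ => 0

/-- The q-VECTOR `e₁ ⊗ ⋯ ⊗ e₁` at label `j`. MODEL DATA. [claim: Mochizuki2012, status: disputed] -/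
def bVec (j : toyIndex.Label) (vQ : toyIndex.VQ) : flipShells.Packet j vQ := bpure j vQ fun _ => 1

/-- The `k`-th COORDINATE FUNCTIONAL of the tensor packet: `x₀ ⊗ ⋯ ⊗ x_j ↦ ∏_i (x_i)_k`. [folklore] -/
def coord (k : Fin 2) (j : toyIndex.Label) (vQ : toyIndex.VQ) : flipShells.Packet j vQ →ₗ[ℚ] ℚ :=
  haveI := toyFibreUnique vQ
  PiTensorProduct.lift ((MultilinearMap.mkPiAlgebra ℚ (toyIndex.Caps j) ℚ).compLinearMap
    fun _ => (LinearMap.proj k : Plane →ₗ[ℚ] ℚ).comp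
      (LinearMap.proj (R := ℚ) (φ := fun _ : toyIndex.Fibre vQ => Plane) default))

/-- The coordinate functional on a bpure tensor. [folklore] -/
theorem coord_tprod (k : Fin 2) (j : toyIndex.Label) (vQ : toyIndex.VQ) (x : toyIndex.Caps j → flipShells.Packet1 vQ) :
    coord k j vQ (flipShells.tprod j vQ x) = ∏ i, x i ⟨(), rfl⟩ k := by
  haveI := toyFibreUnique vQ
  unfold coord LogShells.tprod
  erw [PiTensorProduct.lift.tprod]
  rfl

/-- The coordinate functional on a basis bpure tensor: `1` if all indices are `k`, else `0`. [folklore] -/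
theorem coord_bpure (k : Fin 2) (j : toyIndex.Label) (vQ : toyIndex.VQ) (ε : toyIndex.Caps j → Fin 2) :
    coord k j vQ (bpure j vQ ε) = if ∀ i, ε i = k then 1 else 0 := by
  unfold bpure
  rw [coord_tprod]
  split_ifs with h
  · exact Finset.prod_eq_one fun i _ => by rw [show bvec (ε i) vQ ⟨(), rfl⟩ = Pi.single (ε i) 1 from rfl, h i, Pi.single_eq_same]
  · obtain ⟨i, hi⟩ := not_forall.mp h
    exact Finset.prod_eq_zero (Finset.mem_univ i) (by rw [show bvec (ε i) vQ ⟨(), rfl⟩ = Pi.single (ε i) 1 from rfl, Pi.single_eq_of_ne' hi])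

/-- `e₀^{⊗(j+1)} ≠ e₁^{⊗(j+1)}` (separated by the `0`-th coordinate functional). [folklore] -/
theorem aVec_ne_bVec (j : toyIndex.Label) (vQ : toyIndex.VQ) : aVec j vQ ≠ bVec j vQ := by
  intro h
  have h0 := congrArg (coord 0 j vQ) h
  unfold aVec bVec at h0
  rw [coord_bpure, coord_bpure, if_pos fun _ => rfl, if_neg] at h0
  · exact one_ne_zero h0
  · intro h1; exact absurd (h1 (Fin.last _)) (by decide)

/-- **THE FLIP FAMILY**: the (Ind2)-family «cflip on every summand of every factor». MODEL DATA. [claim: Mochizuki2012, status: disputed] -/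
def flipFam : flipShells.PacketAut := fun j vQ => flipShells.factorwise j vQ fun _ => flipShells.summandwise vQ fun _ => cflip

/-- The cflip family is an (Ind2)-family. [folklore] -/
theorem flipFam_mem_Ind2Family : flipFam ∈ flipShells.Ind2Family := fun _ _ =>
  ⟨fun _ _ => cflip, fun _ _ => Set.mem_insert_of_mem _ rfl, rfl⟩

/-- The cflip family lies in `⟨(Ind1) ∪ (Ind2)⟩`. [folklore] -/
theorem flipFam_mem_closure : flipFam ∈ Subgroup.closure (flipShells.Ind1Family ∪ flipShells.Ind2Family) :=
  Subgroup.subset_closure (Or.inr flipFam_mem_Ind2Family)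

/-- The cflip family flips every index of a basis bpure tensor. [folklore] -/
theorem flipFam_bpure (j : toyIndex.Label) (vQ : toyIndex.VQ) (ε : toyIndex.Caps j → Fin 2) :
    flipFam j vQ (bpure j vQ ε) = bpure j vQ fun i => Equiv.swap (0 : Fin 2) 1 (ε i) := by
  unfold flipFam bpure
  rw [LogShells.tprod, ← LogShells.tprod, LogShells.factorwise_summandwise_tprod]
  congr 1
  funext i v
  exact cflip_single (ε i)

/-- **The cflip family carries the Θ-vector onto the q-vector.** [folklore] -/
theorem flipFam_aVec (j : toyIndex.Label) (vQ : toyIndex.VQ) : flipFam j vQ (aVec j vQ) = bVec j vQ := by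
  unfold aVec bVec; rw [flipFam_bpure]; rfl

/-- … and the q-vector onto the Θ-vector. [folklore] -/
theorem flipFam_bVec (j : toyIndex.Label) (vQ : toyIndex.VQ) : flipFam j vQ (bVec j vQ) = aVec j vQ := by
  unfold aVec bVec; rw [flipFam_bpure]; rfl

/-! ## 3. The tensor log-shell `C_j` (the basis bpure tensors) is permuted by every indeterminacy -/

variable (j : toyIndex.Label) (vQ : toyIndex.VQ)

/-- **The TENSOR LOG-SHELL `C_j`**: the `2^{j+1}` basis bpure tensors `e_{ε₀} ⊗ ⋯ ⊗ e_{ε_j}` of the packet — the integral structure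
`𝓘(^{S^±_{j+1}};𝒟⊢)` of the model, the container every indeterminacy preserves. MODEL DATA. [claim: Mochizuki2012, status: disputed] -/
def tShell : Set (flipShells.Packet j vQ) := Set.range (bpure j vQ)

/-- The tensor log-shell is finite. [folklore] -/
theorem tShell_finite : (tShell j vQ).Finite := Set.finite_range _

/-- The Θ-vector lies in the tensor log-shell. [folklore] -/
theorem aVec_mem_tShell : aVec j vQ ∈ tShell j vQ := ⟨_, rfl⟩

/-- The q-vector lies in the tensor log-shell. [folklore] -/
theorem bVec_mem_tShell : bVec j vQ ∈ tShell j vQ := ⟨_, rfl⟩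

/-- The tensor log-shell has two distinct points (so it is no singleton). [folklore] -/
theorem not_tShell_subset_singleton (x : flipShells.Packet j vQ) : ¬ tShell j vQ ⊆ {x} := fun h =>
  aVec_ne_bVec j vQ ((h (aVec_mem_tShell j vQ)).trans (h (bVec_mem_tShell j vQ)).symm)

/-- A factorwise–summandwise family of flips maps basis bpure tensors to basis bpure tensors. [folklore] -/
theorem factorwise_summandwise_bpure (g : toyIndex.Caps j → ∀ v : toyIndex.Fibre vQ, Plane ≃ₗ[ℚ] Plane)
    (hg : ∀ i v, g i v ∈ flips) (ε : toyIndex.Caps j → Fin 2) :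
    ∃ ε' : toyIndex.Caps j → Fin 2,
      flipShells.factorwise j vQ (fun i => flipShells.summandwise vQ (g i)) (bpure j vQ ε) = bpure j vQ ε' := by
  haveI := toyFibreUnique vQ
  choose k' hk' using fun i => exists_single_of_mem_flips (hg i default) (ε i)
  refine ⟨k', ?_⟩
  unfold bpure
  rw [LogShells.factorwise_summandwise_tprod]
  congr 1
  funext i v
  rw [Unique.eq_default v]
  exact hk' i

/-- A permutation of the capsule permutes the indices of a basis bpure tensor. [folklore] -/
theorem permute_bpure (σ : Equiv.Perm (toyIndex.Caps j)) (ε : toyIndex.Caps j → Fin 2) :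
    flipShells.permute j vQ σ (bpure j vQ ε) = bpure j vQ fun i => ε (σ.symm i) :=
  flipShells.permute_tprod j vQ σ _

/-- An element of (Ind2) maps the tensor log-shell into itself. [folklore] -/
theorem mapsTo_tShell_of_mem_Ind2 {φ : flipShells.Packet j vQ ≃ₗ[ℚ] flipShells.Packet j vQ} (hφ : φ ∈ flipShells.Ind2 j vQ) :
    Set.MapsTo φ (tShell j vQ) (tShell j vQ) := by
  obtain ⟨g, hg, rfl⟩ := hφ
  rintro _ ⟨ε, rfl⟩
  obtain ⟨ε', h⟩ := factorwise_summandwise_bpure j vQ g hg ε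
  exact ⟨ε', h.symm⟩

/-- An element of (Ind1) maps the tensor log-shell into itself. [folklore] -/
theorem mapsTo_tShell_of_mem_Ind1 {Φ : ∀ vQ : toyIndex.VQ, flipShells.Packet j vQ ≃ₗ[ℚ] flipShells.Packet j vQ}
    (hΦ : Φ ∈ flipShells.Ind1 j) : Set.MapsTo (Φ vQ) (tShell j vQ) (tShell j vQ) := by
  obtain ⟨σ, h, hh, hΦ⟩ := hΦ
  rintro _ ⟨ε, rfl⟩
  rw [hΦ vQ, LinearEquiv.trans_apply, permute_bpure]
  obtain ⟨ε', h'⟩ := factorwise_summandwise_bpure j vQ (fun i v => h i v.1) (fun i v => hh i v.1) fun i => ε (σ.symm i)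
  exact ⟨ε', h'.symm⟩

/-- A linear automorphism mapping the (finite) tensor log-shell into itself maps it ONTO itself. [folklore] -/
theorem image_tShell_eq_of_mapsTo {φ : flipShells.Packet j vQ ≃ₗ[ℚ] flipShells.Packet j vQ} (h : Set.MapsTo φ (tShell j vQ) (tShell j vQ)) :
    φ '' tShell j vQ = tShell j vQ :=
  Set.eq_of_subset_of_ncard_le h.image_subset (by rw [Set.ncard_image_of_injective _ φ.injective]) (tShell_finite j vQ)

variable {j vQ}

/-- **Every element of `⟨(Ind1) ∪ (Ind2)⟩` PERMUTES THE TENSOR LOG-SHELL** (so every indeterminacy orbit of a point of `C_j` stays in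
`C_j` — print's «compactness of the `𝒰`», Cor. 3.12 proof p. 175 l. 2–4, holds in the model by design). [folklore] -/
theorem image_tShell_of_mem_closure {Φ : flipShells.PacketAut}
    (hΦ : Φ ∈ Subgroup.closure (flipShells.Ind1Family ∪ flipShells.Ind2Family)) (j : toyIndex.Label) (vQ : toyIndex.VQ) :
    Φ j vQ '' tShell j vQ = tShell j vQ := by
  induction hΦ using Subgroup.closure_induction generalizing j vQ with
  | mem Ψ hΨ =>
    rcases hΨ with h1 | h2
    · exact image_tShell_eq_of_mapsTo j vQ (mapsTo_tShell_of_mem_Ind1 j vQ (h1 j))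
    · exact image_tShell_eq_of_mapsTo j vQ (mapsTo_tShell_of_mem_Ind2 j vQ (h2 j vQ))
  | one => exact Set.image_id _
  | mul Ψ Ψ' _ _ hΨ hΨ' =>
    show (fun x => Ψ j vQ (Ψ' j vQ x)) '' tShell j vQ = tShell j vQ
    rw [← Set.image_image (Ψ j vQ) (Ψ' j vQ), hΨ' j vQ, hΨ j vQ]
  | inv Ψ _ hΨ =>
    show (Ψ j vQ).symm '' tShell j vQ = tShell j vQ
    conv_lhs => rw [← hΨ j vQ, Set.image_image]
    simp only [LinearEquiv.symm_apply_apply, Set.image_id']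

/-- In particular every indeterminacy translate of the Θ-vector is a point of the tensor log-shell. [folklore] -/
theorem apply_aVec_mem_tShell {Φ : flipShells.PacketAut}
    (hΦ : Φ ∈ Subgroup.closure (flipShells.Ind1Family ∪ flipShells.Ind2Family)) (j : toyIndex.Label) (vQ : toyIndex.VQ) :
    Φ j vQ (aVec j vQ) ∈ tShell j vQ := by
  rw [← image_tShell_of_mem_closure hΦ j vQ]
  exact Set.mem_image_of_mem _ (aVec_mem_tShell j vQ)

end Summit.ABC.IUTFork.Repair.ObstructionSS14

end
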